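import Mathlib.Analysis.InnerProductSpace.LinearMap
import Mathlib.Analysis.Calculus.Deriv.Mul
import Mathlib.Analysis.Calculus.Deriv.Add
import HarnessLib

/-!
# Kato–Lai 1984, Theorem A: local existence for abstract nonlinear evolution equations
`du/dt + A(t, u) = 0`

Topic `Literature/Analysis/FluidPDE`. Source: T. Kato, C. Y. Lai, *Nonlinear evolution equations
and the Euler flow*, J. Funct. Anal. **56** (1984) 15–28, §3 (statement, p. 18) and §8 (proof,
pp. 25–27). This is the abstract theorem ("hopefully new", p. 16) from which the paper derives the
local `H^s` theory of the incompressible Euler equations in a bounded domain (Thm I, §5); it is the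
first node of the decomposition of the named fact
`Literature.Analysis.FluidPDE.KatoLai1984_periodicCylinderSmoothExistence`
(`KatoLaiPeriodicCylinder.lean`), vendored on its own because it is pure functional analysis,
stateable with Mathlib's notions today, and reusable ("it has many other applications", p. 16).

## What is printed (§3, p. 18)

* An **admissible triplet** `{V, H, X}` is a family of three real separable Banach spaces with
  (i) `V ⊂ H ⊂ X`, the inclusions continuous and dense; (ii) `H` a Hilbert space with inner product
  `( | )_H`; (iii) a continuous, nondegenerate bilinear form `⟨ , ⟩` on `V × X` such that
  `⟨v, u⟩ = (v | u)_H` for `v ∈ V`, `u ∈ H` (3.1).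
* **Theorem A.** Let `{V, H, X}` be an admissible triplet. Let `A` be a sequentially weakly
  continuous map on `I_{T₀} × H` into `X` (`I_T = [0, T]`) such that
  `⟨v, A(t, v)⟩ ≥ −β(‖v‖²_H)` for `t ∈ I_{T₀}`, `v ∈ V` (3.2), where `β(r) ≥ 0` is a monotone
  increasing function of `r ≥ 0`. Then for any `φ ∈ H` there is `T > 0`, `T ≤ T₀`, and a solution
  `u` of `dₜu + A(t, u) = 0`, `u(0) = φ` (A) in the class `u ∈ C_w(I_T; H) ∩ C¹_w(I_T; X)` (3.3).
  Moreover `‖u(t)‖²_H ≤ p(t)`, `t ∈ I_T` (3.4), where `p` is monotone increasing on `I_T`; `T` and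
  `p` can be chosen so as to depend only on `β` and `‖φ‖_H`. Remark (b): `T` and `p` can be
  determined by solving `p' = 2β(p)`, `p(0) = ‖φ‖²_H` (3.5); `T` may be any value such that `p`
  exists on `I_T`; if the solution of (3.5) is not unique, `p` should be the maximal solution.
  Remark (d): there is in general no uniqueness in Theorem A.
* Proof (§8): Galerkin approximation on finite-dimensional subspaces `M ⊂ V` with an
  `H`-orthonormal basis `e₁, …, e_m`, the projection extended to `X` by `Pf = Σ ⟨e_j, f⟩ e_j`
  (8.2), Peano's theorem for the finite-dimensional system (8.4), the energy identity
  `dₜ‖u‖² = −2⟨u, A(t, u)⟩ ≤ 2β(‖u‖²)`; then nested `M₁ ⊂ M₂ ⊂ ⋯` with dense union, the uniform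
  bound, a diagonal weak extraction on a countable dense set of times, equicontinuity of
  `(v | u_j(t))` from the boundedness of `A` on bounded sets, and passage to the limit in
  `(v, u_j(t)) − (v, P_jφ) = −∫₀ᵗ ⟨v, A(s, u_j(s))⟩ ds`, which "extends to all `v ∈ V` and proves that
  `u` is a solution of (A)" (p. 27).

## Rendering

* `KatoLai.AdmissibleTriplet V H X` bundles the two inclusions as injective continuous linear maps
  with dense range and the pairing as a continuous bilinear map `V →L[ℝ] X →L[ℝ] ℝ` with (3.1) and
  nondegeneracy in the `X` slot; nondegeneracy in the `V` slot is then automatic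
  (`KatoLai.AdmissibleTriplet.eq_zero_of_forall_pairing_eq_zero`). Separability and completeness
  are instance hypotheses of the theorem, as printed.
* `KatoLai.IsSeqWeaklyContinuousOn S A`: `tₙ → t` in `S` and `wₙ ⇀ w` weakly in `H` imply
  `A(tₙ, wₙ) ⇀ A(t, w)` weakly in `X` (tested against the topological dual `StrongDual ℝ X`).
* `KatoLai.IsSolution`: the class (3.3) and equation (A) in the form in which they are proved on
  p. 27 — `u(0) = φ`, `t ↦ (h | u(t))_H` continuous on `I_T` for every `h ∈ H`, and for every
  `v ∈ V` the function `t ↦ ⟨v, u(t)⟩` has derivative `−⟨v, A(t, u(t))⟩` within `I_T`, the latter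
  continuous on `I_T` (so `u` is weakly `C¹` into `X` tested against `V`, which separates the
  points of `X` by nondegeneracy; testing against all of `X*` is not asserted).
* `β` is taken `Monotone` and nonnegative on all of `ℝ` (the printed `β` lives on `r ≥ 0`; extend
  it by `β(0)` to `r < 0` — only values at `r ≥ 0` are ever used).
* (3.4)–(3.5) with Remark (b) are rendered in **supersolution form**, which avoids the solvability
  and maximality issues of the scalar equation (3.5) for a merely monotone `β`: for every
  `T ∈ (0, T₀]` and every `p` differentiable on `I_T` with `p(0) ≥ ‖φ‖²_H` and `p' > 2β(p)` on
  `I_T` there is a solution on `I_T` with `‖u(t)‖²_H ≤ p(t)`. This is what Step 1 of the proof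
  gives (comparison of `dₜ‖u_m‖² ≤ 2β(‖u_m‖²)` with a strict supersolution) and it exhibits the
  printed dependence of `T` and of the bound on `β` and `‖φ‖_H` only; the printed bound by the
  maximal solution of (3.5) for one and the same `u` is **not** asserted (no uniqueness,
  Remark (d)). The printed "there is `T > 0`, `T ≤ T₀`, and a solution" is the proved corollary
  `KatoLai1984_thmA.exists_solution` (take `p(t) = ‖φ‖² + Ct`, `C = 2β(‖φ‖² + 1) + 1`,
  `T = min T₀ C⁻¹`).

## What is NOT here

The discharge `KatoLai1984_thmA_holds` (planned: Peano's theorem in finite dimension, which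
Mathlib lacks — it has Picard–Lindelöf and Grönwall only —, the Galerkin system, and the limit
passage with `Literature.Analysis.FunctionSpaces.DiagonalWeakLimits`); Theorems I–III of the
paper (the Euler application needs Sobolev spaces up to a curved boundary, the Leray projection
on `H^s(Ω)` and elliptic Neumann regularity, none of which the tree has).

Mathlib/tree search: `lean search 'Galerkin|Peano|weakly continuous|evolution equation'` — the
tree has Galerkin machinery only on the flat torus in Fourier variables (`NSGalerkin*`,
`EnergySpaceTorus`) and no abstract evolution-equation existence theorem; Mathlib has
`IsPicardLindelof`, `gronwallBound`, `StrongDual`, `innerSL`, `Submodule.starProjection_tendsto_self`.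
-/

noncomputable section

open Set Filter Topology
open scoped RealInnerProductSpace

namespace Literature.Analysis.FluidPDE

universe u v w

namespace KatoLai

variable {V : Type u} {H : Type v} {X : Type w}
  [NormedAddCommGroup V] [NormedSpace ℝ V] [NormedAddCommGroup H] [InnerProductSpace ℝ H]
  [NormedAddCommGroup X] [NormedSpace ℝ X]

variable (V H X) in
/-- **Admissible triplet** `{V, H, X}` (Kato–Lai 1984, §3, p. 18): `V ⊂ H ⊂ X` with continuous
dense inclusions — here injective continuous linear maps `inclVH`, `inclHX` with dense range —,
`H` a real Hilbert space (instance arguments; completeness and separability of the three spaces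
are hypotheses of Theorem A), and a continuous bilinear form `⟨v, f⟩ = pairing v f` on `V × X`,
nondegenerate, with `⟨v, u⟩ = (v | u)_H` for `v ∈ V`, `u ∈ H` (3.1). Nondegeneracy in `v` follows
from (3.1) and injectivity (`eq_zero_of_forall_pairing_eq_zero`), so only nondegeneracy in `f` is a
field. [cite: KatoLai1984, §3 (p. 18), admissible triplet] -/
structure AdmissibleTriplet where
  /-- The inclusion `V ⊂ H` as a continuous linear map. -/
  inclVH : V →L[ℝ] H
  /-- The inclusion `H ⊂ X` as a continuous linear map. -/
  inclHX : H →L[ℝ] X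
  /-- `V ⊂ H` is an inclusion. -/
  injective_inclVH : Function.Injective inclVH
  /-- `V` is dense in `H`. -/
  denseRange_inclVH : DenseRange inclVH
  /-- `H ⊂ X` is an inclusion. -/
  injective_inclHX : Function.Injective inclHX
  /-- `H` is dense in `X`. -/
  denseRange_inclHX : DenseRange inclHX
  /-- The continuous bilinear form `⟨v, f⟩` on `V × X`. -/
  pairing : V →L[ℝ] X →L[ℝ] ℝ
  /-- Compatibility (3.1): `⟨v, u⟩ = (v | u)_H` for `v ∈ V`, `u ∈ H`. -/
  pairing_inclHX : ∀ (v : V) (u : H), pairing v (inclHX u) = ⟪inclVH v, u⟫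
  /-- Nondegeneracy in the `X` slot: `V` separates the points of `X`. -/
  pairing_nondegenerate : ∀ f : X, (∀ v : V, pairing v f = 0) → f = 0

namespace AdmissibleTriplet

/-- Nondegeneracy of the pairing in the `V` slot is automatic: if `⟨v, f⟩ = 0` for all `f ∈ X`
then `(v | u)_H = 0` for all `u ∈ H` by (3.1), so `v = 0` in `H`, hence in `V`
(Kato–Lai 1984, §3, "continuous, nondegenerate bilinear form"). [cite: KatoLai1984, §3 (p. 18)] -/
theorem eq_zero_of_forall_pairing_eq_zero (𝒯 : AdmissibleTriplet V H X) {v : V}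
    (h : ∀ f : X, 𝒯.pairing v f = 0) : v = 0 := by
  have h1 : 𝒯.inclVH v = 0 := by
    rw [← inner_self_eq_zero (𝕜 := ℝ), ← 𝒯.pairing_inclHX]
    exact h _
  exact 𝒯.injective_inclVH (by rw [h1, map_zero])

/-- The pairing of `v ∈ V` with its own image in `X` is `‖v‖²_H` (3.1). [cite: KatoLai1984, §3 (p. 18), (3.1)] -/
theorem pairing_self (𝒯 : AdmissibleTriplet V H X) (v : V) :
    𝒯.pairing v (𝒯.inclHX (𝒯.inclVH v)) = ‖𝒯.inclVH v‖ ^ 2 := by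
  rw [𝒯.pairing_inclHX, real_inner_self_eq_norm_sq]

variable (H) in
/-- The **trivial admissible triplet** `{H, H, H}` of a real Hilbert space: identity inclusions and
the inner product as pairing (the case `V = H = X` of Kato–Lai's definition; shows the structure is
inhabited). [cite: KatoLai1984, §3 (p. 18)] -/
def trivial : AdmissibleTriplet H H H where
  inclVH := ContinuousLinearMap.id ℝ H
  inclHX := ContinuousLinearMap.id ℝ H
  injective_inclVH := fun _ _ h => h
  denseRange_inclVH := Function.surjective_id.denseRange
  injective_inclHX := fun _ _ h => h
  denseRange_inclHX := Function.surjective_id.denseRange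
  pairing := innerSL ℝ
  pairing_inclHX := fun _ _ => rfl
  pairing_nondegenerate := fun f hf => by
    have := hf f
    rwa [innerSL_apply_apply, inner_self_eq_zero (𝕜 := ℝ)] at this

/-- The pairing of the trivial triplet is the inner product. [cite: KatoLai1984, §3 (p. 18)] -/
@[simp]
theorem trivial_pairing_apply (v f : H) : (trivial H).pairing v f = ⟪v, f⟫ := rfl

end AdmissibleTriplet

/-- **Sequential weak continuity** of `A : I × H → X` on the time set `S` (Kato–Lai 1984, Thm A:
"a (sequentially) weakly continuous map on `I_{T₀} × H` into `X`"): whenever `tₙ → t` within `S`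
and `wₙ ⇀ w` weakly in the Hilbert space `H` (i.e. `(h | wₙ) → (h | w)` for every `h`), then
`A(tₙ, wₙ) ⇀ A(t, w)` weakly in `X` (i.e. `ℓ(A(tₙ, wₙ)) → ℓ(A(t, w))` for every `ℓ ∈ X*`). [cite: KatoLai1984, §3 Thm A (p. 18)] -/
def IsSeqWeaklyContinuousOn (S : Set ℝ) (A : ℝ → H → X) : Prop :=
  ∀ (t : ℕ → ℝ) (t' : ℝ) (w : ℕ → H) (w' : H), (∀ n, t n ∈ S) → t' ∈ S →
    Tendsto t atTop (𝓝 t') → (∀ h : H, Tendsto (fun n => ⟪h, w n⟫) atTop (𝓝 ⟪h, w'⟫)) →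
    ∀ ℓ : StrongDual ℝ X, Tendsto (fun n => ℓ (A (t n) (w n))) atTop (𝓝 (ℓ (A t' w')))

/-- Sequential weak continuity is inherited by smaller time sets. [cite: KatoLai1984, §3 Thm A (p. 18)] -/
theorem IsSeqWeaklyContinuousOn.mono {S S' : Set ℝ} {A : ℝ → H → X}
    (hA : IsSeqWeaklyContinuousOn S A) (hS : S' ⊆ S) : IsSeqWeaklyContinuousOn S' A :=
  fun t t' w w' ht ht' => hA t t' w w' (fun n => hS (ht n)) (hS ht')

/-- **Solutions of (A) in the class (3.3)** on `I_T = [0, T]` (Kato–Lai 1984, Thm A and the last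
paragraph of its proof, p. 27): `u(0) = φ`; `u ∈ C_w(I_T; H)`, i.e. `t ↦ (h | u(t))_H` is continuous
on `I_T` for every `h ∈ H`; and `dₜu + A(t, u) = 0` with `dₜu ∈ C_w(I_T; X)` in the form tested
against `V`: for every `v ∈ V`, `t ↦ ⟨v, u(t)⟩` has derivative `−⟨v, A(t, u(t))⟩` within `I_T` at
every `t ∈ I_T`, and this derivative is continuous on `I_T` (the paper obtains
`⟨v, u(t)⟩ − ⟨v, φ⟩ = −∫₀ᵗ ⟨v, A(s, u(s))⟩ ds` for all `v ∈ V` with a weakly continuous integrand;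
`V` separates the points of `X`). Values of `u` outside `I_T` are irrelevant. [cite: KatoLai1984, §3 Thm A (p. 18), (A) and (3.3)] -/
structure IsSolution (𝒯 : AdmissibleTriplet V H X) (A : ℝ → H → X) (φ : H) (T : ℝ) (u : ℝ → H) :
    Prop where
  /-- The initial condition `u(0) = φ`. -/
  initial : u 0 = φ
  /-- `u ∈ C_w(I_T; H)`. -/
  continuousOn_inner : ∀ h : H, ContinuousOn (fun t => ⟪h, u t⟫) (Icc 0 T)
  /-- The equation `dₜ⟨v, u⟩ = −⟨v, A(t, u)⟩` on `I_T`, for every `v ∈ V`. -/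
  hasDerivWithinAt : ∀ v : V, ∀ t ∈ Icc 0 T,
    HasDerivWithinAt (fun s => 𝒯.pairing v (𝒯.inclHX (u s))) (-(𝒯.pairing v (A t (u t))))
      (Icc 0 T) t
  /-- `dₜu ∈ C_w(I_T; X)` tested against `V`. -/
  continuousOn_pairing_A : ∀ v : V, ContinuousOn (fun t => 𝒯.pairing v (A t (u t))) (Icc 0 T)

/-- For a solution, `t ↦ ⟨v, u(t)⟩ = (v | u(t))_H` is continuous on `I_T` (from the derivative, or
from weak continuity and (3.1)). [cite: KatoLai1984, §3 Thm A (p. 18)] -/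
theorem IsSolution.continuousOn_pairing {𝒯 : AdmissibleTriplet V H X} {A : ℝ → H → X} {φ : H}
    {T : ℝ} {u : ℝ → H} (hu : IsSolution 𝒯 A φ T u) (v : V) :
    ContinuousOn (fun t => 𝒯.pairing v (𝒯.inclHX (u t))) (Icc 0 T) :=
  fun t ht => (hu.hasDerivWithinAt v t ht).continuousWithinAt

end KatoLai

open KatoLai in
/-- **Kato–Lai 1984, Theorem A** (local existence for `dₜu + A(t, u) = 0`, `u(0) = φ`, p. 18;
proof §8, pp. 25–27), in the supersolution form of (3.4)–(3.5) and Remark (b) (module docstring,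
"Rendering"): let `{V, H, X}` be an admissible triplet of real separable Banach spaces, `H`
Hilbert; let `A : I_{T₀} × H → X` be sequentially weakly continuous with
`⟨v, A(t, v)⟩ ≥ −β(‖v‖²_H)` for `t ∈ I_{T₀}`, `v ∈ V`, `β ≥ 0` monotone increasing. Then for every
`φ ∈ H`, every `T` with `0 < T ≤ T₀` and every `p` differentiable on `I_T` with `p(0) ≥ ‖φ‖²_H` and
`p'(t) > 2β(p(t))` on `I_T`, there is a solution `u ∈ C_w(I_T; H) ∩ C¹_w(I_T; X)` of (A)
(`KatoLai.IsSolution`) with `‖u(t)‖²_H ≤ p(t)` for `t ∈ I_T`. In particular `T` and the bound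
depend only on `β` and `‖φ‖_H`; the printed form "there is `T > 0`, `T ≤ T₀`, and a solution" is
`KatoLai1984_thmA.exists_solution`. No uniqueness is asserted (Remark (d)). [cite: KatoLai1984, §3 Thm A (p. 18) with Remark (b) (p. 19); proof §8 (pp. 25–27)] -/
def KatoLai1984_thmA : Prop :=
  ∀ (V : Type u) (H : Type v) (X : Type w) [NormedAddCommGroup V] [NormedSpace ℝ V] [CompleteSpace V]
    [TopologicalSpace.SeparableSpace V] [NormedAddCommGroup H] [InnerProductSpace ℝ H]
    [CompleteSpace H] [TopologicalSpace.SeparableSpace H] [NormedAddCommGroup X] [NormedSpace ℝ X]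
    [CompleteSpace X] [TopologicalSpace.SeparableSpace X]
    (𝒯 : AdmissibleTriplet V H X) (T₀ : ℝ) (A : ℝ → H → X) (β : ℝ → ℝ)
    (_hA : IsSeqWeaklyContinuousOn (Icc 0 T₀) A) (_hβ : Monotone β) (_hβ0 : ∀ r, 0 ≤ β r)
    (_hcoercive : ∀ t ∈ Icc 0 T₀, ∀ v : V,
      -β (‖𝒯.inclVH v‖ ^ 2) ≤ 𝒯.pairing v (A t (𝒯.inclVH v)))
    (φ : H) (T : ℝ) (_hT : 0 < T) (_hTT₀ : T ≤ T₀) (p p' : ℝ → ℝ)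
    (_hp : ∀ t ∈ Icc 0 T, HasDerivWithinAt p (p' t) (Icc 0 T) t) (_hp0 : ‖φ‖ ^ 2 ≤ p 0)
    (_hsuper : ∀ t ∈ Icc 0 T, 2 * β (p t) < p' t),
    ∃ u : ℝ → H, IsSolution 𝒯 A φ T u ∧ ∀ t ∈ Icc 0 T, ‖u t‖ ^ 2 ≤ p t

open KatoLai in
/-- **The printed form of Theorem A from the supersolution form**: under the hypotheses of
Theorem A with `T₀ > 0`, for every `φ ∈ H` there are `T ∈ (0, T₀]` and a solution of (A) in the
class (3.3) on `I_T`, with `‖u(t)‖²_H ≤ ‖φ‖²_H + Ct` — take the affine strict supersolution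
`p(t) = ‖φ‖²_H + Ct`, `C = 2β(‖φ‖²_H + 1) + 1`, on `I_T`, `T = min T₀ C⁻¹`, where `p ≤ ‖φ‖²_H + 1` and
so `2β(p) ≤ 2β(‖φ‖²_H + 1) < C = p'` by monotonicity (Kato–Lai 1984, Thm A, p. 18). [cite: KatoLai1984, §3 Thm A (p. 18)] -/
theorem KatoLai1984_thmA.exists_solution (hThmA : KatoLai1984_thmA.{u, v, w}) {V : Type u}
    {H : Type v} {X : Type w}
    [NormedAddCommGroup V] [NormedSpace ℝ V] [CompleteSpace V] [TopologicalSpace.SeparableSpace V]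
    [NormedAddCommGroup H] [InnerProductSpace ℝ H] [CompleteSpace H]
    [TopologicalSpace.SeparableSpace H] [NormedAddCommGroup X] [NormedSpace ℝ X] [CompleteSpace X]
    [TopologicalSpace.SeparableSpace X] (𝒯 : AdmissibleTriplet V H X) {T₀ : ℝ} (hT₀ : 0 < T₀)
    {A : ℝ → H → X} {β : ℝ → ℝ} (hA : IsSeqWeaklyContinuousOn (Icc 0 T₀) A) (hβ : Monotone β)
    (hβ0 : ∀ r, 0 ≤ β r)
    (hcoercive : ∀ t ∈ Icc 0 T₀, ∀ v : V, -β (‖𝒯.inclVH v‖ ^ 2) ≤ 𝒯.pairing v (A t (𝒯.inclVH v)))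
    (φ : H) :
    ∃ T : ℝ, 0 < T ∧ T ≤ T₀ ∧ ∃ u : ℝ → H, IsSolution 𝒯 A φ T u ∧
      ∀ t ∈ Icc 0 T, ‖u t‖ ^ 2 ≤ ‖φ‖ ^ 2 + (2 * β (‖φ‖ ^ 2 + 1) + 1) * t := by
  set C : ℝ := 2 * β (‖φ‖ ^ 2 + 1) + 1 with hC
  have hCpos : 0 < C := by have := hβ0 (‖φ‖ ^ 2 + 1); positivity
  set T : ℝ := min T₀ C⁻¹ with hTdef
  have hT : 0 < T := lt_min hT₀ (inv_pos.2 hCpos)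
  have hTT₀ : T ≤ T₀ := min_le_left _ _
  have hTC : T ≤ C⁻¹ := min_le_right _ _
  refine ⟨T, hT, hTT₀, ?_⟩
  set p : ℝ → ℝ := fun t => ‖φ‖ ^ 2 + C * t with hpdef
  have hp : ∀ t ∈ Icc 0 T, HasDerivWithinAt p C (Icc 0 T) t := fun t _ => by
    have h1 : HasDerivAt (fun s : ℝ => C * s) (C * 1) t := (hasDerivAt_id t).const_mul C
    rw [mul_one] at h1
    exact (h1.const_add (‖φ‖ ^ 2)).hasDerivWithinAt
  have hsuper : ∀ t ∈ Icc 0 T, 2 * β (p t) < C := fun t ht => by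
    have hpt : p t ≤ ‖φ‖ ^ 2 + 1 := by
      have h1 : C * t ≤ C * C⁻¹ := mul_le_mul_of_nonneg_left (ht.2.trans hTC) hCpos.le
      rw [mul_inv_cancel₀ hCpos.ne'] at h1
      show ‖φ‖ ^ 2 + C * t ≤ ‖φ‖ ^ 2 + 1
      linarith
    have h2 : β (p t) ≤ β (‖φ‖ ^ 2 + 1) := hβ hpt
    rw [hC]
    linarith
  obtain ⟨u, hu, hbound⟩ := hThmA V H X 𝒯 T₀ A β hA hβ hβ0 hcoercive φ T hT hTT₀ p (fun _ => C) hp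
    (by simp [hpdef]) hsuper
  exact ⟨u, hu, fun t ht => hbound t ht⟩

end Literature.Analysis.FluidPDE
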